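import Literature.MathematicalPhysics.QuantumManyBody.PeriodicBoseGasLemma24
import HarnessLib

/-!
# Fournais 2020, (2.28): the commutator bound `[b_p, b_p†] ≤ n`, proved

Topic `Literature/MathematicalPhysics/QuantumManyBody` (provefact
`Literature.MathematicalPhysics.QuantumManyBody.BoseGas.Fournais2020_condensation`, layer `Fournais2020_lemma24`).
This file discharges the named fact `Fournais2020_eq228` (`PeriodicBoseGasLemma24Facts.lean`), one
of the three inputs of `Fournais2020_lemma24_of_facts` (`PeriodicBoseGasLemma24.lean`):
`theorem Fournais2020_eq228_holds : Fournais2020_eq228`, i.e.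
`‖b_p†Φ‖² ≤ ‖b_pΦ‖² + n‖Φ‖²` on `L²(Λ(u)ⁿ)` — the printed "on the `n`-particle sector,
`[b_k, b_k†] = ℓ⁻³(a₀†a₀⟨χ_Λe^{-ikx}, χ_Λe^{-ikx}⟩ - a†(Qχ_Λe^{-ikx})a(Qχ_Λe^{-ikx})) ≤ n`"
[Fournais2020, (2.28)], in first quantisation and without Fock space:

* `q := Q(χ_Λe^{2πi⟨·,p⟩})` (one-body); `𝓕(χ_ΛQψ)(p) = ∫_Λ conj(q)ψ` (`Q` is an orthogonal projection
  of `L²(Λ)`, `fourier_locFun_mul_projQ_eq`), whence for a.e. `X` (integrable slices)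
  `b_pΦ = ∑ᵢ PᵢM̄ᵢΦ` with `M̄ᵢ` the multiplication by `conj q(xᵢ)` (`bVec_eq_sum_ae`), while
  `b_p†Φ = ∑ᵢ MᵢPᵢΦ` by definition (`bDagVec`);
* Gram expansion `‖∑ᵢFᵢ‖² = ∑ᵢⱼRe⟨Fᵢ,Fⱼ⟩`; for `i ≠ j` the entries of the two Gram matrices agree,
  `⟨PᵢM̄ᵢΦ, PⱼM̄ⱼΦ⟩ = ⟨MⱼPⱼΦ, MᵢPᵢΦ⟩` (`Pᵢ = Pᵢ*`, `PᵢPⱼ = PⱼPᵢ`, `[Pᵢ, Mⱼ] = 0`; the calculus of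
  `PeriodicBoseGasPQ.lean`), so only the diagonal survives:
  `‖b†Φ‖² - ‖bΦ‖² = ∑ᵢ(‖MᵢPᵢΦ‖² - ‖PᵢM̄ᵢΦ‖²) ≤ ∑ᵢ ℓ⁻³‖q‖²‖PᵢΦ‖² ≤ n‖Φ‖²`,
  using `‖q‖²_{L²} ≤ ∫_Λ|χ_Λe_p|² ≤ ℓ³∫χ² = ℓ³` (`Q` a contraction) and `‖PᵢΦ‖ ≤ ‖Φ‖`.

No new definitions.

## References

* [Fournais2020] S. Fournais, *Length scales for BEC in the dilute Bose gas*, arXiv:2011.00309,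
  EMS Ser. Congr. Rep. 18 (2021), doi:10.4171/ecr/18-1/7: (2.5), (2.27)–(2.28), (3.5).
* [FournaisSolovej2020] S. Fournais, J. P. Solovej, *The energy of dilute Bose gases*,
  Ann. of Math. 192 (2020) 893–976: §6 (the operators `b_k`).
-/

noncomputable section

open MeasureTheory Set
open scoped ENNReal NNReal FourierTransform ComplexConjugate RealInnerProductSpace

namespace Literature.MathematicalPhysics.QuantumManyBody.BoseGas

/-! ### The one-body function `q = Q(χ_Λ e_p)` -/

section OneBody

variable {χ : Space → ℝ} {ℓ : ℝ}

/-- `φ_p = χ_Λ e^{2πi⟨·,p⟩}` is continuous. [cite: Fournais2020, (2.27)] -/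
theorem continuous_locWave (hχc : Continuous χ) (ℓ : ℝ) (u p : Space) : Continuous (locWave χ ℓ u p) := by
  unfold locWave locFun
  have h1 : Continuous fun y : Space => ℓ⁻¹ • (y - u) := by fun_prop
  have h2 : Continuous fun y : Space => ⟪y, p⟫ := continuous_id.inner continuous_const
  exact (Complex.continuous_ofReal.comp (hχc.comp h1)).mul
    (continuous_subtype_val.comp (Real.continuous_fourierChar.comp h2))

/-- `Qφ_p` is measurable. [cite: Fournais2020, (2.27)] -/
theorem measurable_projQ_locWave (hχc : Continuous χ) (ℓ : ℝ) (u p : Space) :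
    Measurable (projQ ℓ u (locWave χ ℓ u p)) :=
  measurable_projQ ℓ u (continuous_locWave hχc ℓ u p).measurable

/-- A bounded `φ` has a bounded `Q_uφ`: `‖Q_uφ‖_∞ ≤ ‖φ‖_∞ + |⟨φ⟩_Λ|`. [cite: Fournais2020, (3.5)] -/
theorem norm_projQ_le_of_bound (ℓ : ℝ) (u : Space) {φ : Space → ℂ} {C : ℝ} (hC : ∀ y, ‖φ y‖ ≤ C)
    (y : Space) :
    ‖projQ ℓ u φ y‖ ≤ C + ‖((ℓ ^ 3)⁻¹ : ℝ) • ∫ z in slidingBox ℓ u, φ z‖ := by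
  have hC0 : 0 ≤ C := (norm_nonneg _).trans (hC y)
  unfold projQ
  by_cases hy : y ∈ slidingBox ℓ u
  · rw [indicator_of_mem hy]
    exact (norm_sub_le _ _).trans (by gcongr; exact hC y)
  · rw [indicator_of_notMem hy, norm_zero]
    positivity

/-- `Qφ_p` is bounded. [cite: Fournais2020, (2.27)] -/
theorem exists_bound_projQ_locWave (hχ : IsLocalizationFunction χ) (ℓ : ℝ) (u p : Space) :
    ∃ C, ∀ y, ‖projQ ℓ u (locWave χ ℓ u p) y‖ ≤ C := by
  obtain ⟨Cχ, hCχ⟩ := hχ.exists_bound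
  refine ⟨Cχ + ‖((ℓ ^ 3)⁻¹ : ℝ) • ∫ z in slidingBox ℓ u, locWave χ ℓ u p z‖, fun y => ?_⟩
  refine norm_projQ_le_of_bound ℓ u (fun z => ?_) y
  rw [norm_locWave]
  exact (Real.norm_eq_abs _ ▸ hCχ _ :)

/-- `∫ χ_Λ² = ℓ³` (`∫χ² = 1` and the scaling `x = u + ℓt`), in `ℝ≥0∞`. [cite: Fournais2020, (2.2)–(2.3)] -/
theorem lintegral_locFun_sq (hχ : IsLocalizationFunction χ) (hℓ : 0 < ℓ) (u : Space) :
    ∫⁻ y, ENNReal.ofReal (locFun χ ℓ u y ^ 2) = ENNReal.ofReal ℓ ^ 3 := by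
  have hint : Integrable fun t : Space => χ t ^ 2 := by
    have h : HasCompactSupport fun t : Space => χ t * χ t := hχ.hasCompactSupport.mul_left
    have h2 := (hχ.continuous.mul hχ.continuous).integrable_of_hasCompactSupport (μ := volume) h
    exact h2.congr (Filter.Eventually.of_forall fun t => by simp [sq])
  calc ∫⁻ y, ENNReal.ofReal (locFun χ ℓ u y ^ 2)
      = ∫⁻ y, (fun w : Space => ENNReal.ofReal (χ (ℓ⁻¹ • w) ^ 2)) (y - u) := rfl
    _ = ∫⁻ w, ENNReal.ofReal (χ (ℓ⁻¹ • w) ^ 2) :=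
        lintegral_sub_right_eq_self (μ := (volume : Measure Space))
          (fun w : Space => ENNReal.ofReal (χ (ℓ⁻¹ • w) ^ 2)) u
    _ = ENNReal.ofReal (ℓ ^ 3) * ∫⁻ t, ENNReal.ofReal (χ t ^ 2) :=
        lintegral_comp_inv_smul hℓ (f := fun t : Space => ENNReal.ofReal (χ t ^ 2))
          (hχ.continuous.pow 2).measurable.ennreal_ofReal
    _ = ENNReal.ofReal ℓ ^ 3 := by
        rw [← ofReal_integral_eq_lintegral_ofReal hint (Filter.Eventually.of_forall fun t => sq_nonneg _),
          hχ.integral_sq, ENNReal.ofReal_one, mul_one, ENNReal.ofReal_pow hℓ.le]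

/-- **`‖Qφ_p‖² ≤ ℓ³`** (`Q` is a contraction on `L²(Λ)` and `∫_Λ|φ_p|² ≤ ∫χ_Λ² = ℓ³`): the
normalisation `⟨χ_Λe^{-ikx}, χ_Λe^{-ikx}⟩ = ℓ³∫χ² ` behind the factor `n` in (2.28).
[cite: Fournais2020, (2.28)] -/
theorem lintegral_normSq_projQ_locWave_le (hχ : IsLocalizationFunction χ) (hℓ : 0 < ℓ) (u p : Space) :
    ∫⁻ y, (‖projQ ℓ u (locWave χ ℓ u p) y‖₊ : ℝ≥0∞) ^ 2 ≤ ENNReal.ofReal ℓ ^ 3 := by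
  calc ∫⁻ y, (‖projQ ℓ u (locWave χ ℓ u p) y‖₊ : ℝ≥0∞) ^ 2
      ≤ ∫⁻ y in slidingBox ℓ u, (‖locWave χ ℓ u p y‖₊ : ℝ≥0∞) ^ 2 :=
        lintegral_nnnorm_sq_projQ_le hℓ u (continuous_locWave hχ.continuous ℓ u p)
    _ ≤ ∫⁻ y, (‖locWave χ ℓ u p y‖₊ : ℝ≥0∞) ^ 2 := setLIntegral_le_lintegral _ _
    _ = ∫⁻ y, ENNReal.ofReal (locFun χ ℓ u y ^ 2) := by
        refine lintegral_congr fun y => ?_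
        rw [coe_nnnorm_sq_eq_ofReal, norm_locWave, sq_abs]
    _ = ENNReal.ofReal ℓ ^ 3 := lintegral_locFun_sq hχ hℓ u

/-- `conj φ_p = χ_Λ e^{-2πi⟨·,p⟩}`: the Fourier kernel against `χ_Λ`. [cite: Fournais2020, (2.27)] -/
theorem conj_locWave (χ : Space → ℝ) (ℓ : ℝ) (u p y : Space) :
    conj (locWave χ ℓ u p y) = (locFun χ ℓ u y : ℂ) * (𝐞 (-⟪y, p⟫) : ℂ) := by
  rw [locWave, map_mul, Complex.conj_ofReal, AddChar.map_neg_eq_inv, Circle.coe_inv_eq_conj]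

/-- **The amplitude against `Qφ_p`.** For `ψ` integrable on `Λ(u)`,
`𝓕(χ_Λ Q_uψ)(p) = ∫_Λ conj(Q_uφ_p) ψ` (`⟨χ_Λe_p, Qψ⟩ = ⟨Q(χ_Λe_p), ψ⟩`, `Q` being the orthogonal
projection of `L²(Λ)` onto the complement of the constants). [cite: Fournais2020, (2.27), (3.5)] -/
theorem fourier_locFun_mul_projQ_eq (hχ : IsLocalizationFunction χ) (ℓ : ℝ) (u p : Space)
    {ψ : Space → ℂ} (hψ : IntegrableOn ψ (slidingBox ℓ u) volume) :
    𝓕 (fun y => (locFun χ ℓ u y : ℂ) * projQ ℓ u ψ y) p =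
      ∫ y in slidingBox ℓ u, conj (projQ ℓ u (locWave χ ℓ u p) y) * ψ y := by
  haveI : IsFiniteMeasure ((volume : Measure Space).restrict (slidingBox ℓ u)) :=
    isFiniteMeasure_restrict_slidingBox ℓ u
  obtain ⟨Cχ, hCχ⟩ := hχ.exists_bound
  have hA := measurableSet_slidingBox ℓ u
  set φ : Space → ℂ := locWave χ ℓ u p with hφ
  have hφc : Continuous φ := continuous_locWave hχ.continuous ℓ u p
  have hφb : ∀ y, ‖φ y‖ ≤ Cχ := fun y => by
    rw [hφ, norm_locWave]; exact (Real.norm_eq_abs _ ▸ hCχ _ :)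
  set cψ : ℂ := ((ℓ ^ 3)⁻¹ : ℝ) • ∫ y in slidingBox ℓ u, ψ y with hcψ
  set cφ : ℂ := ((ℓ ^ 3)⁻¹ : ℝ) • ∫ y in slidingBox ℓ u, φ y with hcφ
  -- integrability on the box
  have hφψ : IntegrableOn (fun y => conj (φ y) * ψ y) (slidingBox ℓ u) volume := by
    refine Integrable.bdd_mul (c := Cχ) hψ ?_ (Filter.Eventually.of_forall fun y => ?_)
    · exact (Complex.continuous_conj.comp hφc).aestronglyMeasurable
    · rw [Complex.norm_conj]; exact hφb y
  have hφi : IntegrableOn (fun y => conj (φ y)) (slidingBox ℓ u) volume :=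
    integrableOn_slidingBox (Complex.continuous_conj.comp hφc) ℓ u
  -- the left-hand side: `∫ conj(φ) Qψ = ∫_Λ conj(φ)ψ - (∫_Λ conj φ) cψ`
  have hL : 𝓕 (fun y => (locFun χ ℓ u y : ℂ) * projQ ℓ u ψ y) p =
      (∫ y in slidingBox ℓ u, conj (φ y) * ψ y) - (∫ y in slidingBox ℓ u, conj (φ y)) * cψ := by
    rw [Real.fourier_eq]
    have h1 : ∀ y : Space, (𝐞 (-⟪y, p⟫) : Circle) • ((locFun χ ℓ u y : ℂ) * projQ ℓ u ψ y) =
        (slidingBox ℓ u).indicator (fun y => conj (φ y) * (ψ y - cψ)) y := by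
      intro y
      rw [Circle.smul_def, smul_eq_mul, show projQ ℓ u ψ = (slidingBox ℓ u).indicator (fun y => ψ y - cψ) from rfl,
        indicator_mul_right _ (fun y => conj (φ y)), conj_locWave]
      ring
    simp_rw [h1]
    rw [integral_indicator hA]
    simp_rw [mul_sub]
    rw [integral_sub hφψ (hφi.mul_const _), integral_mul_const]
  -- the right-hand side: `∫_Λ conj(Qφ) ψ = ∫_Λ conj(φ)ψ - conj(cφ) ∫_Λ ψ`
  have hR : ∫ y in slidingBox ℓ u, conj (projQ ℓ u φ y) * ψ y =
      (∫ y in slidingBox ℓ u, conj (φ y) * ψ y) - conj cφ * ∫ y in slidingBox ℓ u, ψ y := by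
    have h1 : EqOn (fun y => conj (projQ ℓ u φ y) * ψ y) (fun y => conj (φ y) * ψ y - conj cφ * ψ y)
        (slidingBox ℓ u) := by
      intro y hy
      simp only
      rw [show projQ ℓ u φ = (slidingBox ℓ u).indicator (fun y => φ y - cφ) from rfl, indicator_of_mem hy,
        map_sub, sub_mul]
    rw [setIntegral_congr_fun hA h1, integral_sub hφψ (hψ.const_mul _), integral_const_mul]
  rw [hL, hR, integral_conj, hcψ, hcφ, Complex.real_smul, Complex.real_smul, map_mul, Complex.conj_ofReal]
  ring

end OneBody

/-! ### `L²(Λⁿ)` algebra: bounded multipliers, `Pᵢ = Pᵢ*`, Gram expansion of a finite sum -/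

section L2Algebra

variable {m : ℕ} {ℓ : ℝ} {u : Space}

/-- A bounded measurable multiplier preserves `L²`. [folklore] -/
theorem memLp_two_bdd_mul {α : Type*} [MeasurableSpace α] {μ : Measure α} {g F : α → ℂ}
    (hg : AEStronglyMeasurable g μ) {C : ℝ} (hC : ∀ x, ‖g x‖ ≤ C) (hF : MemLp F 2 μ) :
    MemLp (fun x => g x * F x) 2 μ :=
  MemLp.of_le_mul (c := C) hF (hg.mul hF.1) (Filter.Eventually.of_forall fun x => by
    rw [norm_mul]; exact mul_le_mul_of_nonneg_right (hC x) (norm_nonneg _))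

/-- `Re⟨F, F⟩ = ‖F‖² ≥ 0`, and `(∫conj(F)F).re = ∫‖F‖²`. [folklore] -/
theorem integral_conj_mul_self_re {α : Type*} [MeasurableSpace α] {μ : Measure α} (F : α → ℂ) :
    (∫ x, conj (F x) * F x ∂μ).re = ∫ x, ‖F x‖ ^ 2 ∂μ := by
  have h : (fun x => conj (F x) * F x) = fun x => (((‖F x‖ ^ 2 : ℝ)) : ℂ) := by
    funext x; rw [Complex.conj_mul', Complex.ofReal_pow]
  rw [h, integral_complex_ofReal, Complex.ofReal_re]

/-- **`Pᵢ` is self-adjoint on `L²(Λⁿ⁺¹)`**: `⟨PᵢF, G⟩ = ⟨F, PᵢG⟩`. [cite: Fournais2020, (2.5)] -/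
theorem integral_conj_nbodyP_mul (hℓ : 0 < ℓ) (i : Fin (m + 1)) {F G : Config (m + 1) → ℂ}
    (hFm : Measurable F) (hF : MemLp F 2 (volume.restrict (boxConfig (m + 1) ℓ u)))
    (hGm : Measurable G) (hG : MemLp G 2 (volume.restrict (boxConfig (m + 1) ℓ u))) :
    ∫ X in boxConfig (m + 1) ℓ u, conj (nbodyP ℓ u i F X) * G X =
      ∫ X in boxConfig (m + 1) ℓ u, conj (F X) * nbodyP ℓ u i G X := by
  have hPF := memLp_nbodyP hℓ i hFm hF
  have hPG := memLp_nbodyP hℓ i hGm hG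
  -- `⟨PᵢF, G⟩ = ⟨PᵢF, PᵢG⟩`
  have h1 : ∫ X in boxConfig (m + 1) ℓ u, conj (nbodyP ℓ u i F X) * G X =
      ∫ X in boxConfig (m + 1) ℓ u, conj (nbodyP ℓ u i F X) * nbodyP ℓ u i G X :=
    (integral_conj_mul_nbodyP hℓ i (fun X y => nbodyP_update ℓ u i F X y) (integrable_conj_mul hPF hG)).symm
  -- `⟨F, PᵢG⟩ = conj⟨PᵢG, F⟩ = conj⟨PᵢG, PᵢF⟩ = ⟨PᵢF, PᵢG⟩`
  have h2 : ∫ X in boxConfig (m + 1) ℓ u, conj (F X) * nbodyP ℓ u i G X =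
      conj (∫ X in boxConfig (m + 1) ℓ u, conj (nbodyP ℓ u i G X) * F X) := by
    rw [← integral_conj]
    refine integral_congr_ae (Filter.Eventually.of_forall fun X => ?_)
    simp only [map_mul, Complex.conj_conj, mul_comm]
  have h3 : ∫ X in boxConfig (m + 1) ℓ u, conj (nbodyP ℓ u i G X) * F X =
      ∫ X in boxConfig (m + 1) ℓ u, conj (nbodyP ℓ u i G X) * nbodyP ℓ u i F X :=
    (integral_conj_mul_nbodyP hℓ i (fun X y => nbodyP_update ℓ u i G X y) (integrable_conj_mul hPG hF)).symm
  rw [h1, h2, h3, ← integral_conj]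
  refine integral_congr_ae (Filter.Eventually.of_forall fun X => ?_)
  simp only [map_mul, Complex.conj_conj, mul_comm]

/-- **Gram expansion**: `‖∑ᵢFᵢ‖² = ∑ᵢ∑ⱼ Re⟨Fᵢ, Fⱼ⟩` in `L²`. [folklore] -/
theorem integral_norm_sq_sum_eq {α : Type*} [MeasurableSpace α] {μ : Measure α} {k : ℕ}
    {F : Fin k → α → ℂ} (hF : ∀ i, MemLp (F i) 2 μ) :
    ∫ x, ‖∑ i, F i x‖ ^ 2 ∂μ = ∑ i, ∑ j, (∫ x, conj (F i x) * F j x ∂μ).re := by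
  have hpt : ∀ x, ‖∑ i, F i x‖ ^ 2 = ∑ i, ∑ j, (conj (F i x) * F j x).re := by
    intro x
    have h : ((‖∑ i, F i x‖ ^ 2 : ℝ) : ℂ) = ∑ i, ∑ j, conj (F i x) * F j x := by
      rw [Complex.ofReal_pow, ← Complex.conj_mul', map_sum, Finset.sum_mul_sum]
    have h' := congrArg Complex.re h
    rw [Complex.ofReal_re] at h'
    rw [h', Complex.re_sum]
    exact Finset.sum_congr rfl fun i _ => Complex.re_sum _ _
  simp_rw [hpt]
  have hint : ∀ i j, Integrable (fun x => (conj (F i x) * F j x).re) μ := fun i j =>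
    (integrable_conj_mul (hF i) (hF j)).re
  rw [integral_finsetSum _ fun i _ => integrable_finsetSum _ fun j _ => hint i j]
  refine Finset.sum_congr rfl fun i _ => ?_
  rw [integral_finsetSum _ fun j _ => hint i j]
  refine Finset.sum_congr rfl fun j _ => ?_
  exact integral_re (integrable_conj_mul (hF i) (hF j))

end L2Algebra

/-! ### The operators `Mᵢ = q(xᵢ)·`, and `b_p = ∑ᵢ Pᵢ M̄ᵢ`, `b_p† = ∑ᵢ MᵢPᵢ` on `L²(Λⁿ)` -/

section Operators

variable {m : ℕ} {ℓ : ℝ} {u : Space}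

/-- `Y ↦ q(Yᵢ)` is measurable on `Λⁿ`. [folklore] -/
theorem measurable_comp_eval {q : Space → ℂ} (hq : Measurable q) (i : Fin (m + 1)) :
    Measurable fun Y : Config (m + 1) => q (Y i) :=
  hq.comp (measurable_pi_apply i)

/-- `M̄ᵢΦ = conj(q(xᵢ))Φ ∈ L²` for bounded `q`. [cite: Fournais2020, (2.27)] -/
theorem memLp_conj_mul {q : Space → ℂ} (hq : Measurable q) {C : ℝ} (hC : ∀ y, ‖q y‖ ≤ C) (i : Fin (m + 1))
    {Φ : Config (m + 1) → ℂ} (hΦ : MemLp Φ 2 (volume.restrict (boxConfig (m + 1) ℓ u))) :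
    MemLp (fun Y => conj (q (Y i)) * Φ Y) 2 (volume.restrict (boxConfig (m + 1) ℓ u)) :=
  memLp_two_bdd_mul (Complex.continuous_conj.measurable.comp (measurable_comp_eval hq i)).aestronglyMeasurable
    (fun Y => by rw [Complex.norm_conj]; exact hC _) hΦ

/-- `MᵢΦ = q(xᵢ)Φ ∈ L²` for bounded `q`. [cite: Fournais2020, (2.27)] -/
theorem memLp_mul {q : Space → ℂ} (hq : Measurable q) {C : ℝ} (hC : ∀ y, ‖q y‖ ≤ C) (i : Fin (m + 1))
    {Φ : Config (m + 1) → ℂ} (hΦ : MemLp Φ 2 (volume.restrict (boxConfig (m + 1) ℓ u))) :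
    MemLp (fun Y => q (Y i) * Φ Y) 2 (volume.restrict (boxConfig (m + 1) ℓ u)) :=
  memLp_two_bdd_mul (measurable_comp_eval hq i).aestronglyMeasurable (fun Y => hC (Y i)) hΦ

/-- **The off-diagonal terms of `bb†` and `b†b` coincide**: for `i ≠ j`,
`⟨PᵢM̄ᵢΦ, PⱼM̄ⱼΦ⟩ = ⟨MⱼPⱼΦ, MᵢPᵢΦ⟩` (operators on different particles commute; `Pᵢ = Pᵢ*`).
[cite: Fournais2020, (2.28)] -/
theorem integral_offDiag_eq (hℓ : 0 < ℓ) {i j : Fin (m + 1)} (hij : i ≠ j) {q : Space → ℂ}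
    (hq : Measurable q) {C : ℝ} (hC : ∀ y, ‖q y‖ ≤ C) {Φ : Config (m + 1) → ℂ} (hΦm : Measurable Φ)
    (hΦ : MemLp Φ 2 (volume.restrict (boxConfig (m + 1) ℓ u))) :
    ∫ X in boxConfig (m + 1) ℓ u, conj (nbodyP ℓ u i (fun Y => conj (q (Y i)) * Φ Y) X) *
        nbodyP ℓ u j (fun Y => conj (q (Y j)) * Φ Y) X =
      ∫ X in boxConfig (m + 1) ℓ u, conj (q (X j) * nbodyP ℓ u j Φ X) * (q (X i) * nbodyP ℓ u i Φ X) := by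
  -- the players and their `L²` membership
  have hMim : Measurable fun Y : Config (m + 1) => conj (q (Y i)) * Φ Y :=
    (Complex.continuous_conj.measurable.comp (measurable_comp_eval hq i)).mul hΦm
  have hMjm : Measurable fun Y : Config (m + 1) => conj (q (Y j)) * Φ Y :=
    (Complex.continuous_conj.measurable.comp (measurable_comp_eval hq j)).mul hΦm
  have hMi := memLp_conj_mul (ℓ := ℓ) (u := u) hq hC i hΦ
  have hMj := memLp_conj_mul (ℓ := ℓ) (u := u) hq hC j hΦ
  have hPjMj := memLp_nbodyP hℓ j hMjm hMj
  have hPiΦm := measurable_nbodyP ℓ u i hΦm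
  have hPiΦ := memLp_nbodyP hℓ i hΦm hΦ
  -- `N = M̄ⱼPᵢΦ = PᵢM̄ⱼΦ`
  have hN : nbodyP ℓ u i (fun Y => conj (q (Y j)) * Φ Y) = fun X => conj (q (X j)) * nbodyP ℓ u i Φ X := by
    funext X
    exact nbodyP_mul_left ℓ u i (H := fun Y => conj (q (Y j)))
      (fun _ _ => by simp only [Function.update_of_ne hij.symm]) Φ X
  have hNm : Measurable fun X : Config (m + 1) => conj (q (X j)) * nbodyP ℓ u i Φ X :=
    (Complex.continuous_conj.measurable.comp (measurable_comp_eval hq j)).mul hPiΦm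
  have hN2 : MemLp (fun X => conj (q (X j)) * nbodyP ℓ u i Φ X) 2 (volume.restrict (boxConfig (m + 1) ℓ u)) :=
    memLp_conj_mul hq hC j hPiΦ
  -- `G' = Mᵢ N`
  have hG'm : Measurable fun X : Config (m + 1) => q (X i) * (conj (q (X j)) * nbodyP ℓ u i Φ X) :=
    (measurable_comp_eval hq i).mul hNm
  have hG'2 : MemLp (fun X => q (X i) * (conj (q (X j)) * nbodyP ℓ u i Φ X)) 2
      (volume.restrict (boxConfig (m + 1) ℓ u)) := memLp_mul hq hC i hN2
  -- Step 1: `⟨PᵢM̄ᵢΦ, PⱼM̄ⱼΦ⟩ = ⟨M̄ᵢΦ, PᵢPⱼM̄ⱼΦ⟩`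
  rw [integral_conj_nbodyP_mul hℓ i hMim hMi (measurable_nbodyP ℓ u j hMjm) hPjMj]
  -- Step 2: `PᵢPⱼ = PⱼPᵢ` a.e.
  have h2 : ∫ X in boxConfig (m + 1) ℓ u, conj (conj (q (X i)) * Φ X) *
      nbodyP ℓ u i (nbodyP ℓ u j fun Y => conj (q (Y j)) * Φ Y) X =
      ∫ X in boxConfig (m + 1) ℓ u, conj (conj (q (X i)) * Φ X) *
        nbodyP ℓ u j (nbodyP ℓ u i fun Y => conj (q (Y j)) * Φ Y) X := by
    refine integral_congr_ae ?_
    filter_upwards [nbodyP_comm_ae hij hMjm (integrable_of_memLp_two hMj)] with X hX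
    rw [hX]
  rw [h2, hN]
  -- Step 3: `Mᵢ` commutes with `Pⱼ`: `conj(M̄ᵢΦ)·PⱼN = conj(Φ)·Pⱼ(MᵢN)`
  have h3 : ∀ X, conj (conj (q (X i)) * Φ X) * nbodyP ℓ u j (fun X => conj (q (X j)) * nbodyP ℓ u i Φ X) X =
      conj (Φ X) * nbodyP ℓ u j (fun Y => q (Y i) * (conj (q (Y j)) * nbodyP ℓ u i Φ Y)) X := by
    intro X
    rw [nbodyP_mul_left ℓ u j (H := fun Y => q (Y i)) (fun _ _ => by simp only [Function.update_of_ne hij])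
      _ X, map_mul, Complex.conj_conj]
    ring
  simp_rw [h3]
  -- Step 4: `⟨Φ, Pⱼ G'⟩ = ⟨PⱼΦ, G'⟩`
  rw [← integral_conj_nbodyP_mul hℓ j hΦm hΦ hG'm hG'2]
  refine integral_congr_ae (Filter.Eventually.of_forall fun X => ?_)
  simp only [map_mul]
  ring

/-- **The diagonal terms of `b†b`**: `‖MᵢPᵢΦ‖² = ℓ⁻³‖q‖²_{L²(Λ)}‖PᵢΦ‖² ≤ ‖Φ‖²` when `‖q‖² ≤ ℓ³`.
[cite: Fournais2020, (2.28)] -/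
theorem lintegral_normSq_mul_nbodyP_le (hℓ : 0 < ℓ) (i : Fin (m + 1)) {q : Space → ℂ} (hq : Measurable q)
    (hq2 : ∫⁻ y, (‖q y‖₊ : ℝ≥0∞) ^ 2 ≤ ENNReal.ofReal ℓ ^ 3) {Φ : Config (m + 1) → ℂ} (hΦm : Measurable Φ) :
    ∫⁻ X in boxConfig (m + 1) ℓ u, (‖q (X i) * nbodyP ℓ u i Φ X‖₊ : ℝ≥0∞) ^ 2 ≤
      ∫⁻ X in boxConfig (m + 1) ℓ u, (‖Φ X‖₊ : ℝ≥0∞) ^ 2 := by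
  have hℓ3 : ENNReal.ofReal ℓ ^ 3 ≠ 0 := pow_ne_zero _ (by rwa [Ne, ENNReal.ofReal_eq_zero, not_le])
  have hℓ3' : ENNReal.ofReal ℓ ^ 3 ≠ ⊤ := ENNReal.pow_ne_top ENNReal.ofReal_ne_top
  have hPm := measurable_nbodyP ℓ u i hΦm
  have h1 : ∀ X : Config (m + 1), (‖q (X i) * nbodyP ℓ u i Φ X‖₊ : ℝ≥0∞) ^ 2 =
      (‖q (X i)‖₊ : ℝ≥0∞) ^ 2 * (‖nbodyP ℓ u i Φ X‖₊ : ℝ≥0∞) ^ 2 := by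
    intro X
    rw [nnnorm_mul, ENNReal.coe_mul, mul_pow]
  simp_rw [h1]
  rw [lintegral_weight_mul hℓ i (g := fun y => (‖q y‖₊ : ℝ≥0∞) ^ 2) (hq.nnnorm.coe_nnreal_ennreal.pow_const _)
    (G := fun X => (‖nbodyP ℓ u i Φ X‖₊ : ℝ≥0∞) ^ 2) (hPm.nnnorm.coe_nnreal_ennreal.pow_const _)
    (fun X y => by simp only [nbodyP_update])]
  calc (ENNReal.ofReal ℓ ^ 3)⁻¹ * (∫⁻ y in slidingBox ℓ u, (‖q y‖₊ : ℝ≥0∞) ^ 2) *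
        ∫⁻ X in boxConfig (m + 1) ℓ u, (‖nbodyP ℓ u i Φ X‖₊ : ℝ≥0∞) ^ 2
      ≤ (ENNReal.ofReal ℓ ^ 3)⁻¹ * (ENNReal.ofReal ℓ ^ 3) *
        ∫⁻ X in boxConfig (m + 1) ℓ u, (‖nbodyP ℓ u i Φ X‖₊ : ℝ≥0∞) ^ 2 := by
        gcongr
        exact (setLIntegral_le_lintegral _ _).trans hq2
    _ = ∫⁻ X in boxConfig (m + 1) ℓ u, (‖nbodyP ℓ u i Φ X‖₊ : ℝ≥0∞) ^ 2 := by
        rw [ENNReal.inv_mul_cancel hℓ3 hℓ3', one_mul]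
    _ ≤ _ := lintegral_nbodyP_sq_le hℓ i hΦm

end Operators

/-! ### `b_pΦ = ∑ᵢ PᵢM̄ᵢΦ` almost everywhere -/

section Slices

variable {m : ℕ} {χ : Space → ℝ} {ℓ : ℝ} {u : Space}

/-- **The excitation amplitude through `q = Qφ_p`**: for a.e. `X ∈ Λⁿ⁺¹` (those with integrable slices),
`𝓕(χ_ΛQᵢΦ(X;·ᵢ))(p) = ∫_Λ conj(q(y)) Φ(X; xᵢ = y) dy = ℓ³ (PᵢM̄ᵢΦ)(X)` for every `i`.
[cite: Fournais2020, (2.27)] -/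
theorem excAmp_eq_ae (hχ : IsLocalizationFunction χ) (hℓ : 0 < ℓ) (u p : Space) {Φ : Config (m + 1) → ℂ}
    (hΦi : Integrable Φ (volume.restrict (boxConfig (m + 1) ℓ u))) :
    ∀ᵐ X ∂volume.restrict (boxConfig (m + 1) ℓ u), ∀ i : Fin (m + 1),
      excAmp χ ℓ u i Φ X p =
        ((ℓ ^ 3 : ℝ) : ℂ) * nbodyP ℓ u i (fun Y => conj (projQ ℓ u (locWave χ ℓ u p) (Y i)) * Φ Y) X := by
  rw [ae_all_iff]
  intro i
  filter_upwards [ae_integrable_update i hΦi] with X hX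
  have hs : sliceExc χ ℓ u i Φ X = fun y => (locFun χ ℓ u y : ℂ) * projQ ℓ u (fun z => Φ (Function.update X i z)) y :=
    rfl
  rw [excAmp, hs, fourier_locFun_mul_projQ_eq hχ ℓ u p hX, nbodyP]
  simp only [Function.update_self]
  rw [Complex.real_smul, ← mul_assoc, ← Complex.ofReal_mul, mul_inv_cancel₀ (by positivity), Complex.ofReal_one,
    one_mul]

/-- **`b_pΦ = ∑ᵢ PᵢM̄ᵢΦ` a.e.** on `Λⁿ⁺¹` for `Φ ∈ L¹(Λⁿ⁺¹)` (`b = ℓ⁻³a†(θ)a(Qφ_p) = ℓ⁻³∑ᵢ|1⟩⟨q|ᵢ`).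
[cite: Fournais2020, (2.27)] -/
theorem bVec_eq_sum_ae (hχ : IsLocalizationFunction χ) (hℓ : 0 < ℓ) (u p : Space) {Φ : Config (m + 1) → ℂ}
    (hΦi : Integrable Φ (volume.restrict (boxConfig (m + 1) ℓ u))) :
    ∀ᵐ X ∂volume.restrict (boxConfig (m + 1) ℓ u),
      bVec χ ℓ u p Φ X = ∑ i : Fin (m + 1), nbodyP ℓ u i (fun Y => conj (projQ ℓ u (locWave χ ℓ u p) (Y i)) * Φ Y) X := by
  filter_upwards [excAmp_eq_ae hχ hℓ u p hΦi] with X hX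
  rw [bVec]
  simp_rw [hX]
  rw [← Finset.mul_sum, Complex.real_smul, ← mul_assoc, ← Complex.ofReal_mul, inv_mul_cancel₀ (by positivity),
    Complex.ofReal_one, one_mul]

end Slices

/-! ### (2.28) -/

section Assembly

/-- **Fournais 2020, (2.28), proved**: `‖b_p†Φ‖² ≤ ‖b_pΦ‖² + n‖Φ‖²` on `L²(Λ(u)ⁿ)`, i.e. the printed
`[b_k, b_k†] = ℓ⁻³(a₀†a₀⟨χ_Λe^{-ikx}, χ_Λe^{-ikx}⟩ - a†(Qχ_Λe^{-ikx})a(Qχ_Λe^{-ikx})) ≤ n` in expectation.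
First-quantised proof: `b_p = ∑ᵢ PᵢM̄ᵢ`, `b_p† = ∑ᵢ MᵢPᵢ` with `Mᵢ` the multiplication by
`q(xᵢ)`, `q = Q(χ_Λe^{2πi⟨·,p⟩})`; in `‖b†Φ‖² - ‖bΦ‖² = ∑ᵢⱼ(⟨MᵢPᵢΦ, MⱼPⱼΦ⟩ - ⟨PᵢM̄ᵢΦ, PⱼM̄ⱼΦ⟩)` the
terms `i ≠ j` cancel (operators on different particles commute), and the diagonal is
`ℓ⁻³‖q‖²‖PᵢΦ‖² - ‖PᵢM̄ᵢΦ‖² ≤ ‖Φ‖²` since `‖q‖² ≤ ∫χ_Λ² = ℓ³`. [cite: Fournais2020, (2.28)] -/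
theorem Fournais2020_eq228_holds : Fournais2020_eq228 := by
  intro χ hχ ℓ hℓ u n Φ hΦm p
  cases n with
  | zero => simp [bDagVec_zero]
  | succ m =>
  by_cases hfin : ∫⁻ X in boxConfig (m + 1) ℓ u, ((‖Φ X‖₊ : ℝ≥0∞)) ^ 2 = ⊤
  · have htop : ((m + 1 : ℕ) : ℝ≥0∞) * ∫⁻ X in boxConfig (m + 1) ℓ u, ((‖Φ X‖₊ : ℝ≥0∞)) ^ 2 = ⊤ := by
      rw [hfin, ENNReal.mul_top (by exact_mod_cast Nat.succ_ne_zero m)]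
    rw [htop, add_top]
    exact le_top
  -- the main case: `Φ ∈ L²(Λⁿ⁺¹)`
  have hΦ2 : MemLp Φ 2 (volume.restrict (boxConfig (m + 1) ℓ u)) :=
    memLp_two_of_lintegral_ne_top hΦm.aestronglyMeasurable hfin
  have hΦi : Integrable Φ (volume.restrict (boxConfig (m + 1) ℓ u)) := integrable_of_memLp_two hΦ2
  -- `q = Qφ_p`: measurable, bounded, `‖q‖² ≤ ℓ³`
  set q : Space → ℂ := projQ ℓ u (locWave χ ℓ u p) with hq
  have hqm : Measurable q := measurable_projQ_locWave hχ.continuous ℓ u p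
  obtain ⟨Cq, hCq⟩ := exists_bound_projQ_locWave hχ ℓ u p
  have hq2 : ∫⁻ y, (‖q y‖₊ : ℝ≥0∞) ^ 2 ≤ ENNReal.ofReal ℓ ^ 3 := lintegral_normSq_projQ_locWave_le hχ hℓ u p
  -- `Aᵢ = MᵢPᵢΦ`, `Bᵢ = PᵢM̄ᵢΦ`
  set A : Fin (m + 1) → Config (m + 1) → ℂ := fun i X => q (X i) * nbodyP ℓ u i Φ X with hA
  set B : Fin (m + 1) → Config (m + 1) → ℂ := fun i X =>
    nbodyP ℓ u i (fun Y => conj (q (Y i)) * Φ Y) X with hB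
  have hA2 : ∀ i, MemLp (A i) 2 (volume.restrict (boxConfig (m + 1) ℓ u)) := fun i =>
    memLp_mul hqm hCq i (memLp_nbodyP hℓ i hΦm hΦ2)
  have hMm : ∀ i, Measurable fun Y : Config (m + 1) => conj (q (Y i)) * Φ Y := fun i =>
    (Complex.continuous_conj.measurable.comp (measurable_comp_eval hqm i)).mul hΦm
  have hB2 : ∀ i, MemLp (B i) 2 (volume.restrict (boxConfig (m + 1) ℓ u)) := fun i =>
    memLp_nbodyP hℓ i (hMm i) (memLp_conj_mul hqm hCq i hΦ2)
  have hdag : ∀ X, bDagVec χ ℓ u p Φ X = ∑ i, A i X := fun X => rfl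
  have hvec : ∀ᵐ X ∂volume.restrict (boxConfig (m + 1) ℓ u), bVec χ ℓ u p Φ X = ∑ i, B i X :=
    bVec_eq_sum_ae hχ hℓ u p hΦi
  have hSA : MemLp (fun X => ∑ i, A i X) 2 (volume.restrict (boxConfig (m + 1) ℓ u)) :=
    memLp_finsetSum _ fun i _ => hA2 i
  have hSB : MemLp (fun X => ∑ i, B i X) 2 (volume.restrict (boxConfig (m + 1) ℓ u)) :=
    memLp_finsetSum _ fun i _ => hB2 i
  -- the Gram entries
  set a : Fin (m + 1) → Fin (m + 1) → ℝ := fun i j =>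
    (∫ X in boxConfig (m + 1) ℓ u, conj (A i X) * A j X).re with ha
  set b : Fin (m + 1) → Fin (m + 1) → ℝ := fun i j =>
    (∫ X in boxConfig (m + 1) ℓ u, conj (B i X) * B j X).re with hb
  set NΦ : ℝ := (∫⁻ X in boxConfig (m + 1) ℓ u, ((‖Φ X‖₊ : ℝ≥0∞)) ^ 2).toReal with hNΦ
  have hGA : ∫ X in boxConfig (m + 1) ℓ u, ‖∑ i, A i X‖ ^ 2 = ∑ i, ∑ j, a i j := integral_norm_sq_sum_eq hA2
  have hGB : ∫ X in boxConfig (m + 1) ℓ u, ‖∑ i, B i X‖ ^ 2 = ∑ i, ∑ j, b i j := integral_norm_sq_sum_eq hB2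
  -- off-diagonal entries coincide, diagonal ones are controlled
  have hoff : ∀ i j, j ≠ i → b i j = a j i := by
    intro i j hji
    simp only [ha, hb, hA, hB]
    rw [integral_offDiag_eq hℓ (Ne.symm hji) hqm hCq hΦm hΦ2]
  have hbii : ∀ i, 0 ≤ b i i := fun i => by
    simp only [hb]
    rw [integral_conj_mul_self_re]
    exact integral_nonneg fun X => sq_nonneg _
  have haii : ∀ i, a i i ≤ NΦ := by
    intro i
    simp only [ha, hNΦ]
    rw [integral_conj_mul_self_re, integral_norm_sq_eq_toReal (hA2 i).1]
    exact ENNReal.toReal_mono hfin (lintegral_normSq_mul_nbodyP_le hℓ i hqm hq2 hΦm)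
  -- the three terms of (2.28) as `ofReal` of real numbers
  have hLA : ∫⁻ X in boxConfig (m + 1) ℓ u, ((‖bDagVec χ ℓ u p Φ X‖₊ : ℝ≥0∞)) ^ 2 =
      ENNReal.ofReal (∫ X in boxConfig (m + 1) ℓ u, ‖∑ i, A i X‖ ^ 2) := by
    rw [integral_norm_sq_eq_toReal hSA.1, ENNReal.ofReal_toReal (lintegral_ne_top_of_memLp_two hSA)]
    exact lintegral_congr fun X => by rw [hdag]
  have hLB : ∫⁻ X in boxConfig (m + 1) ℓ u, ((‖bVec χ ℓ u p Φ X‖₊ : ℝ≥0∞)) ^ 2 =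
      ENNReal.ofReal (∫ X in boxConfig (m + 1) ℓ u, ‖∑ i, B i X‖ ^ 2) := by
    rw [integral_norm_sq_eq_toReal hSB.1, ENNReal.ofReal_toReal (lintegral_ne_top_of_memLp_two hSB)]
    refine lintegral_congr_ae ?_
    filter_upwards [hvec] with X hX
    rw [hX]
  have hLΦ : ((m + 1 : ℕ) : ℝ≥0∞) * ∫⁻ X in boxConfig (m + 1) ℓ u, ((‖Φ X‖₊ : ℝ≥0∞)) ^ 2 =
      ENNReal.ofReal (((m + 1 : ℕ) : ℝ) * NΦ) := by
    rw [hNΦ, ENNReal.ofReal_mul (by positivity), ENNReal.ofReal_natCast, ENNReal.ofReal_toReal hfin]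
  have hN0 : 0 ≤ NΦ := ENNReal.toReal_nonneg
  rw [hLA, hLB, hLΦ, ← ENNReal.ofReal_add (integral_nonneg fun _ => sq_nonneg _) (by positivity), hGA, hGB]
  refine ENNReal.ofReal_le_ofReal ?_
  -- bookkeeping in `ℝ`
  clear_value a b NΦ A B q
  have h1 := sum_sum_filter_ne_eq a
  have h2 := sum_sum_filter_ne_eq b
  have h3 : ∑ i : Fin (m + 1), ∑ j : Fin (m + 1) with j ≠ i, b i j =
      ∑ i : Fin (m + 1), ∑ j : Fin (m + 1) with j ≠ i, a i j := by
    rw [sum_sum_filter_ne_comm a]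
    exact Finset.sum_congr rfl fun i _ => Finset.sum_congr rfl fun j hj => hoff i j (Finset.mem_filter.1 hj).2
  have h4 : ∑ i : Fin (m + 1), a i i ≤ ((m + 1 : ℕ) : ℝ) * NΦ := by
    calc ∑ i : Fin (m + 1), a i i ≤ ∑ _i : Fin (m + 1), NΦ := Finset.sum_le_sum fun i _ => haii i
      _ = ((m + 1 : ℕ) : ℝ) * NΦ := by simp
  have h5 : 0 ≤ ∑ i : Fin (m + 1), b i i := Finset.sum_nonneg fun i _ => hbii i
  linarith

end Assembly



end Literature.MathematicalPhysics.QuantumManyBody.BoseGas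

end
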